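import Literature.MathematicalPhysics.QuantumLattice.LieTrotter
import HarnessLib

/-!
# Chernoff's product formula in a Banach algebra (bounded case, with rate)

Companion of `Literature.MathematicalPhysics.QuantumLattice.LieTrotter` (the Lie product formula
`(exp (a/N) exp (b/N))^N → exp (a + b)`). For a complete normed algebra `𝔸` over `𝕂 = ℝ` or
`ℂ` with `‖1‖ = 1` we prove the abstract mechanism behind every product formula of
Trotter type, in P. R. Chernoff's form: if the `N`-th approximant `F_N` agrees with the exact
short-time propagator `exp (X/(N+1))` up to an error `ε_N` with `(N + 1) ε_N → 0`, then
`F_N^{N+1} → exp X`. Explicitly: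

* `exp_inv_natCast_succ_smul_pow`: `(exp ((N+1)⁻¹ • X))^{N+1} = exp X`;
* `norm_exp_sub_taylor_le`: the Taylor remainder of any order,
  `‖exp a - Σ_{n<m} a^n/n!‖ ≤ ‖a‖^m e^{‖a‖}` (order `2` is `norm_exp_sub_one_sub_le` of
  `LieTrotter`); `norm_exp_sub_one_sub_sub_le` is the order-`3` instance
  `‖exp a - 1 - a - a²/2‖ ≤ ‖a‖³ e^{‖a‖}`;
* `norm_pow_succ_sub_exp_le`: **one-step Chernoff bound**
  `‖F - exp ((N+1)⁻¹ • X)‖ ≤ ε ⟹ ‖F^{N+1} - exp X‖ ≤ (N + 1) e^{‖X‖ + N ε} ε`;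
* `tendsto_pow_succ_of_norm_sub_exp_le`: **Chernoff's product formula** — if eventually
  `‖F_N - exp ((N+1)⁻¹ • X)‖ ≤ ε_N` and `(N + 1) ε_N → 0` then `F_N^{N+1} → exp X`.

Typical use (quantum lattice systems): `X = -βH`, `F_N` = a Trotter–Suzuki, Hubbard–Stratonovich
or auxiliary-field approximant of `e^{-βH/(N+1)}` accurate to `O((β/N)^{1+δ})` per slice.

Sources. P. R. Chernoff, J. Funct. Anal. 2 (1968) 238–242 (the product formula
`F(t/n)^n → e^{tA}` for contractions `F(t)` with `F'(0) ⊇ A`, strong convergence; the bounded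
case with norm convergence and explicit rate proved here is the elementary telescoping variant,
as in Reed–Simon I, proof of Theorem VIII.29).

## Mathlib search

`rg -i "chernoff"` over Mathlib: only probability (no product formula); the Lie–Trotter material
of the tree is in `LieTrotter.lean` (`norm_pow_sub_pow_le'`, `norm_exp_le`,
`norm_exp_sub_one_sub_le`, `norm_inv_natCast_smul_le`), reused here.
-/

namespace Literature.MathematicalPhysics.QuantumLattice

open NormedSpace Filter Topology
open scoped Nat

section Chernoff

variable {𝕂 𝔸 : Type*} [RCLike 𝕂] [NormedRing 𝔸] [NormedAlgebra 𝕂 𝔸]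

/-- The exact short-time propagator composes exactly: `(exp ((N+1)⁻¹ • X))^{N+1} = exp X`
(`exp_nsmul`). [folklore] -/
theorem exp_inv_natCast_succ_smul_pow [CompleteSpace 𝔸] (X : 𝔸) (N : ℕ) :
    (exp (((N + 1 : ℕ) : 𝕂)⁻¹ • X)) ^ (N + 1) = exp X := by
  letI : NormedAlgebra ℚ 𝔸 := NormedAlgebra.restrictScalars ℚ 𝕂 𝔸
  rw [← exp_nsmul, ← Nat.cast_smul_eq_nsmul 𝕂, smul_smul,
    mul_inv_cancel₀ (by exact_mod_cast Nat.succ_ne_zero N), one_smul]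

variable [NormOneClass 𝔸]

variable (𝕂) in
/-- Taylor remainder of the exponential series of any order `m`:
`‖exp a - Σ_{n<m} a^n/n!‖ ≤ ‖a‖^m e^{‖a‖}` (the tail `Σ_{n ≥ m} a^n/n!` is dominated termwise by
`‖a‖^m Σ_n ‖a‖^n/n!` since `(n + m)! ≥ n!`). Reed–Simon I, §VIII.8. [folklore] -/
theorem norm_exp_sub_taylor_le [CompleteSpace 𝔸] (a : 𝔸) (m : ℕ) :
    ‖exp a - ∑ n ∈ Finset.range m, (n !⁻¹ : 𝕂) • a ^ n‖ ≤ ‖a‖ ^ m * Real.exp ‖a‖ := by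
  have h1 : HasSum (fun n => (n !⁻¹ : 𝕂) • a ^ n) (exp a) := exp_series_hasSum_exp' a
  have h1' : HasSum (fun n => ((n + m) !⁻¹ : 𝕂) • a ^ (n + m))
      (exp a - ∑ n ∈ Finset.range m, (n !⁻¹ : 𝕂) • a ^ n) :=
    (hasSum_nat_add_iff' m).mpr h1
  have h2 : HasSum (fun n => ‖a‖ ^ m * (‖a‖ ^ n / n !)) (‖a‖ ^ m * Real.exp ‖a‖) := by
    rw [Real.exp_eq_exp_ℝ]
    exact (expSeries_div_hasSum_exp ‖a‖).mul_left _
  refine h1'.norm_le_of_bounded h2 fun n => ?_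
  calc ‖((n + m) !⁻¹ : 𝕂) • a ^ (n + m)‖
      ≤ ‖a‖ ^ (n + m) / (n + m) ! := by exact_mod_cast norm_expSeries_term_le 𝕂 a (n + m)
    _ ≤ ‖a‖ ^ (n + m) / n ! := by
        exact div_le_div_of_nonneg_left (by positivity) (by positivity)
          (by exact_mod_cast Nat.factorial_le (Nat.le_add_right n m))
    _ = ‖a‖ ^ m * (‖a‖ ^ n / n !) := by ring

variable (𝕂) in
/-- Third-order Taylor remainder of the exponential: `‖exp a - 1 - a - a²/2‖ ≤ ‖a‖³ e^{‖a‖}`.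
[folklore] -/
theorem norm_exp_sub_one_sub_sub_le [CompleteSpace 𝔸] (a : 𝔸) :
    ‖exp a - 1 - a - (2 : 𝕂)⁻¹ • a ^ 2‖ ≤ ‖a‖ ^ 3 * Real.exp ‖a‖ := by
  have h := norm_exp_sub_taylor_le 𝕂 a 3
  have hsum : ∑ n ∈ Finset.range 3, (n !⁻¹ : 𝕂) • a ^ n = 1 + a + (2 : 𝕂)⁻¹ • a ^ 2 := by
    simp only [Finset.sum_range_succ, Finset.sum_range_zero, zero_add, Nat.factorial_zero,
      Nat.cast_one, inv_one, one_smul, pow_zero, Nat.factorial_one, pow_one, Nat.factorial_two,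
      Nat.cast_ofNat]
  rw [hsum] at h
  simpa only [sub_sub, add_assoc] using h

/-- **One-step Chernoff bound.** If `F` is `ε`-close to the exact short-time propagator
`exp ((N+1)⁻¹ • X)` then `‖F^{N+1} - exp X‖ ≤ (N + 1) e^{‖X‖ + N ε} ε`: both `F` and
`Y = exp ((N+1)⁻¹ • X)` have norm `≤ e^{‖X‖/(N+1)} e^{ε}`, `Y^{N+1} = exp X`, and the telescoping
estimate `norm_pow_sub_pow_le'` applies. Chernoff, J. Funct. Anal. 2 (1968) 238; Reed–Simon I,
proof of Theorem VIII.29. [cite: Chernoff1968, Theorem (p. 238) — variant] -/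
theorem norm_pow_succ_sub_exp_le [CompleteSpace 𝔸] (X F : 𝔸) (N : ℕ) {ε : ℝ}
    (hF : ‖F - exp (((N + 1 : ℕ) : 𝕂)⁻¹ • X)‖ ≤ ε) :
    ‖F ^ (N + 1) - exp X‖ ≤ (N + 1) * Real.exp (‖X‖ + N * ε) * ε := by
  set Y : 𝔸 := exp (((N + 1 : ℕ) : 𝕂)⁻¹ • X) with hY_def
  have hε0 : 0 ≤ ε := (norm_nonneg _).trans hF
  have hNpos : (0 : ℝ) < (N + 1 : ℕ) := by positivity
  set m : ℝ := Real.exp (‖X‖ / (N + 1 : ℕ)) with hm_def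
  have hYm : ‖Y‖ ≤ m :=
    (norm_exp_le 𝕂 _).trans (Real.exp_le_exp.mpr (norm_inv_natCast_smul_le X (N + 1)))
  have hm1 : 1 ≤ m := Real.one_le_exp (by positivity)
  set M : ℝ := m * Real.exp ε with hM_def
  have hmM : m ≤ M := le_mul_of_one_le_right (zero_le_one.trans hm1) (Real.one_le_exp hε0)
  have hYM : ‖Y‖ ≤ M := hYm.trans hmM
  have hFM : ‖F‖ ≤ M := by
    have h1 : ‖F‖ ≤ ε + m :=
      calc ‖F‖ = ‖(F - Y) + Y‖ := by rw [sub_add_cancel]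
        _ ≤ ‖F - Y‖ + ‖Y‖ := norm_add_le _ _
        _ ≤ ε + m := add_le_add hF hYm
    have h2 : ε + m ≤ m * Real.exp ε := by
      have hexp : ε + 1 ≤ Real.exp ε := Real.add_one_le_exp ε
      nlinarith [mul_nonneg (sub_nonneg.2 hm1) hε0]
    exact h1.trans h2
  have hMN : M ^ N ≤ Real.exp (‖X‖ + N * ε) := by
    rw [hM_def, mul_pow, ← Real.exp_nat_mul, ← Real.exp_nat_mul, ← Real.exp_add]
    apply Real.exp_le_exp.mpr
    have h1 : (N : ℝ) * (‖X‖ / (N + 1 : ℕ)) ≤ ‖X‖ := by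
      rw [mul_div_assoc', div_le_iff₀ hNpos]
      push_cast
      nlinarith [norm_nonneg X]
    linarith
  have htel := norm_pow_sub_pow_le' F Y hFM hYM N
  rw [hY_def, exp_inv_natCast_succ_smul_pow] at htel
  calc ‖F ^ (N + 1) - exp X‖ ≤ (N + 1) * M ^ N * ‖F - Y‖ := htel
    _ ≤ (N + 1) * Real.exp (‖X‖ + N * ε) * ε := by gcongr

/-- **Chernoff's product formula (bounded case).** If the approximants `F_N` satisfy, for all
large `N`, `‖F_N - exp ((N+1)⁻¹ • X)‖ ≤ ε_N` with `(N + 1) ε_N → 0`, then `F_N^{N+1} → exp X`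
(indeed `‖F_N^{N+1} - exp X‖ ≤ e^{‖X‖+1} (N + 1) ε_N` once `(N + 1) ε_N ≤ 1`). This is the
norm-convergent, bounded-generator case of Chernoff's theorem (`F(t/n)^n → e^{tA}` strongly for
contractions `F(t)` with `F(0) = 1`, `F'(0) ⊇ A`), which contains the Lie–Trotter formula
(`F(t) = e^{tA}e^{tB}`) and its symmetrised / randomised / auxiliary-field variants.
[cite: Chernoff1968, Theorem (p. 238) — variant] -/
theorem tendsto_pow_succ_of_norm_sub_exp_le [CompleteSpace 𝔸] (X : 𝔸) (F : ℕ → 𝔸)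
    (ε : ℕ → ℝ) (hF : ∀ᶠ N in atTop, ‖F N - exp (((N + 1 : ℕ) : 𝕂)⁻¹ • X)‖ ≤ ε N)
    (hε : Tendsto (fun N : ℕ => ((N : ℝ) + 1) * ε N) atTop (𝓝 0)) :
    Tendsto (fun N => (F N) ^ (N + 1)) atTop (𝓝 (exp X)) := by
  have h1 : ∀ᶠ N : ℕ in atTop, ((N : ℝ) + 1) * ε N ≤ 1 :=
    hε.eventually (ge_mem_nhds one_pos)
  have hbound : ∀ᶠ N : ℕ in atTop,
      ‖(F N) ^ (N + 1) - exp X‖ ≤ Real.exp (‖X‖ + 1) * (((N : ℝ) + 1) * ε N) := by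
    filter_upwards [hF, h1] with N hFN h1N
    have hε0 : 0 ≤ ε N := (norm_nonneg _).trans hFN
    have hNε : (N : ℝ) * ε N ≤ 1 := by nlinarith
    calc ‖(F N) ^ (N + 1) - exp X‖
        ≤ (N + 1) * Real.exp (‖X‖ + N * ε N) * ε N := norm_pow_succ_sub_exp_le X (F N) N hFN
      _ ≤ (N + 1) * Real.exp (‖X‖ + 1) * ε N := by gcongr
      _ = Real.exp (‖X‖ + 1) * (((N : ℝ) + 1) * ε N) := by ring
  rw [tendsto_iff_norm_sub_tendsto_zero]
  refine squeeze_zero_norm' ?_ (by simpa using hε.const_mul (Real.exp (‖X‖ + 1)))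
  filter_upwards [hbound] with N hN
  rwa [Real.norm_of_nonneg (norm_nonneg _)]

/-- **Chernoff's product formula, `N`-th power of the `(N+1)`-st approximant.** Under the same
hypotheses as `tendsto_pow_succ_of_norm_sub_exp_le` (eventually `‖F_N - exp ((N+1)⁻¹ • X)‖ ≤ ε_N`,
`(N + 1) ε_N → 0`) also `F_N^N → exp X`: the exact slices give
`(exp ((N+1)⁻¹ • X))^N = exp ((N/(N+1)) • X) → exp X`, and the telescoping estimate bounds
`‖F_N^N - (exp ((N+1)⁻¹ • X))^N‖ ≤ N e^{‖X‖ + N ε_N} ε_N`.  (Used when one of the `N + 1` slices of a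
Trotter product carries an insertion and only the other `N` are free.)
[cite: Chernoff1968, Theorem (p. 238) — variant] -/
theorem tendsto_pow_of_norm_sub_exp_le [CompleteSpace 𝔸] (X : 𝔸) (F : ℕ → 𝔸)
    (ε : ℕ → ℝ) (hF : ∀ᶠ N in atTop, ‖F N - exp (((N + 1 : ℕ) : 𝕂)⁻¹ • X)‖ ≤ ε N)
    (hε : Tendsto (fun N : ℕ => ((N : ℝ) + 1) * ε N) atTop (𝓝 0)) :
    Tendsto (fun N => (F N) ^ N) atTop (𝓝 (exp X)) := by
  letI : NormedAlgebra ℚ 𝔸 := NormedAlgebra.restrictScalars ℚ 𝕂 𝔸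
  -- the exact slices: `(exp ((N+1)⁻¹ • X))^N = exp ((N/(N+1)) • X) → exp X`
  have hY : Tendsto (fun N : ℕ => (exp (((N + 1 : ℕ) : 𝕂)⁻¹ • X)) ^ N) atTop (𝓝 (exp X)) := by
    have e : ∀ N : ℕ, (exp (((N + 1 : ℕ) : 𝕂)⁻¹ • X)) ^ N = exp (((N : 𝕂) / ((N : 𝕂) + 1)) • X) := by
      intro N
      rw [← exp_nsmul, ← Nat.cast_smul_eq_nsmul 𝕂, smul_smul]
      congr 1
      push_cast
      ring
    simp only [e]
    have h1 : Tendsto (fun N : ℕ => (N : 𝕂) / ((N : 𝕂) + 1)) atTop (𝓝 1) :=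
      tendsto_natCast_div_add_atTop (1 : 𝕂)
    have h2 : Tendsto (fun N : ℕ => ((N : 𝕂) / ((N : 𝕂) + 1)) • X) atTop (𝓝 X) := by
      simpa using h1.smul_const X
    exact (exp_continuous.tendsto X).comp h2
  -- the telescoping estimate for the `N`-th powers
  have h1 : ∀ᶠ N : ℕ in atTop, ((N : ℝ) + 1) * ε N ≤ 1 :=
    hε.eventually (ge_mem_nhds one_pos)
  have hbound : ∀ᶠ N : ℕ in atTop,
      ‖(F N) ^ N - (exp (((N + 1 : ℕ) : 𝕂)⁻¹ • X)) ^ N‖ ≤ Real.exp (‖X‖ + 1) * (((N : ℝ) + 1) * ε N) := by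
    filter_upwards [hF, h1] with N hFN h1N
    have hε0 : 0 ≤ ε N := (norm_nonneg _).trans hFN
    rcases Nat.eq_zero_or_eq_succ_pred N with h0 | hk
    · subst h0
      simp only [pow_zero, sub_self, norm_zero]
      positivity
    · -- `N = k + 1`
      set k := N.pred with hk_def
      set Y : 𝔸 := exp (((N + 1 : ℕ) : 𝕂)⁻¹ • X) with hY_def
      set m : ℝ := Real.exp (‖X‖ / (N + 1 : ℕ)) with hm_def
      have hNpos : (0 : ℝ) < (N + 1 : ℕ) := by positivity
      have hYm : ‖Y‖ ≤ m :=
        (norm_exp_le 𝕂 _).trans (Real.exp_le_exp.mpr (norm_inv_natCast_smul_le X (N + 1)))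
      have hm1 : 1 ≤ m := Real.one_le_exp (by positivity)
      set M : ℝ := m * Real.exp (ε N) with hM_def
      have hYM : ‖Y‖ ≤ M :=
        hYm.trans (le_mul_of_one_le_right (zero_le_one.trans hm1) (Real.one_le_exp hε0))
      have hFM : ‖F N‖ ≤ M := by
        have e1 : ‖F N‖ ≤ ε N + m :=
          calc ‖F N‖ = ‖(F N - Y) + Y‖ := by rw [sub_add_cancel]
            _ ≤ ‖F N - Y‖ + ‖Y‖ := norm_add_le _ _
            _ ≤ ε N + m := add_le_add hFN hYm
        have e2 : ε N + m ≤ m * Real.exp (ε N) := by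
          have hexp : ε N + 1 ≤ Real.exp (ε N) := Real.add_one_le_exp (ε N)
          nlinarith [mul_nonneg (sub_nonneg.2 hm1) hε0]
        exact e1.trans e2
      have hMk : M ^ k ≤ Real.exp (‖X‖ + 1) := by
        rw [hM_def, mul_pow, ← Real.exp_nat_mul, ← Real.exp_nat_mul, ← Real.exp_add]
        apply Real.exp_le_exp.mpr
        have hkN : (k : ℝ) ≤ N := by exact_mod_cast Nat.pred_le N
        have e1 : (k : ℝ) * (‖X‖ / (N + 1 : ℕ)) ≤ ‖X‖ := by
          rw [mul_div_assoc', div_le_iff₀ hNpos]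
          push_cast
          nlinarith [norm_nonneg X]
        have e2 : (k : ℝ) * ε N ≤ 1 := by nlinarith
        linarith
      have htel := norm_pow_sub_pow_le' (F N) Y hFM hYM k
      have hk' : k + 1 = N := by omega
      rw [hk'] at htel
      have hk1 : (k : ℝ) + 1 ≤ (N : ℝ) + 1 := by
        have : (k : ℝ) ≤ N := by exact_mod_cast Nat.pred_le N
        linarith
      have hMk0 : 0 ≤ M ^ k := by positivity
      have step : ((k : ℝ) + 1) * M ^ k * ‖F N - Y‖ ≤ ((N : ℝ) + 1) * Real.exp (‖X‖ + 1) * ε N := by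
        gcongr
      calc ‖F N ^ N - Y ^ N‖ ≤ (k + 1) * M ^ k * ‖F N - Y‖ := htel
        _ ≤ ((N : ℝ) + 1) * Real.exp (‖X‖ + 1) * ε N := step
        _ = Real.exp (‖X‖ + 1) * (((N : ℝ) + 1) * ε N) := by ring
  have hdiff : Tendsto (fun N : ℕ => (F N) ^ N - (exp (((N + 1 : ℕ) : 𝕂)⁻¹ • X)) ^ N) atTop (𝓝 0) := by
    refine squeeze_zero_norm' hbound ?_
    simpa using hε.const_mul (Real.exp (‖X‖ + 1))
  have := hdiff.add hY
  simpa using this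

end Chernoff

end Literature.MathematicalPhysics.QuantumLattice
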